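import Summits.QuantumFields.YangMills.Theorems.UnitScaleTiltProp7ResumPartPackaged
import Summits.QuantumFields.YangMills.Theorems.UnitScaleTiltProp7NonlinPartPackaged
import Summits.QuantumFields.YangMills.Theorems.UnitScaleTiltProp7ResumCoeffRows
import HarnessLib

/-!
# Prop 7, route-R E′, (E1-c) brick F4c(iv-c) — THE PURE-GAUGE PIECE `P₂` UNDER `ℓ²D*_W`: THE DIVERGENCE-LIPSCHITZ ROW IN X-CURRENCY LETTERS (resummed part + nonlinear part)

Route `UnitScaleTilt`, crux K1 child «MinimiserStabilityRegPr» (`stmt-QuantumFields-19200`), cell ym3-torus, width seat px15 (gen 2); pen «px15 g2: (E1-c) GO-LOCATE» (★p1 g15,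
2026-08-28T20:45:05Z), LOCATE `LOCATE-E1C-DIVLIPSCHITZ-px15g2.md` §3∕§6.  THEOREMS ONLY (0 `def`, 0 `sorry`); `--supports stmt-QuantumFields-19200`, count-neutral.
YM₃ on T³ is a ladder rung (R3), not the Clay problem; nothing here claims the stub, the crux, d = 4 or the mass gap.

WHAT.  `P₂(X;H) := log(1 + e^{−X}(e^{X+H} − e^X)) − H` with `X = c•ψ(y)`, `H = c•D_μψ(y)` (`|c| ≤ 1`) is the pure-gauge piece of the chart remainder at the bond `(y,μ)` (F2 ✓p668882,
F3c ✓p671341).  Splitting `P₂ = ĉ(ψ y)(H) + 𝒩` with `ĉ(λ)Z = g(ad(c•λ))Z − Z` (F4b ✓p671886) and adding F4c(iv-a) ✓p672945 (`norm_divB_resumPart_le`, instantiated with F4b's rows: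
cone `2‖λ‖‖Z‖`, `κ = θ = 2e^{2R₀}`, equivariance) to F4c(iv-b) ⧗p673053 (`norm_divB_nonlinPart_le`) gives, for pinned site fields `ψ, ψ′` with sup rows `m ≤ min(R₀,½)`, `m′ ≤ R₀`, `m_d`,
`δ, δ′, δ_d` and a potential `d` toward the pinning set:
  ★★★ `norm_divB_gaugePiece_sub_le`:
  `ℓ²‖D*[P₂ψ − P₂ψ′](x)‖ ≤ 2·max(ℓδ,m)·ρ_x(ψ−ψ′) + 2e^{2R₀}·max(ℓδ_d,m_d)·ρ_x(ψ′) + |ι|ℓ²·2e^{2R₀}·(δδ_d + (δ_d + 4δ′m_d)δ′) + 2|ι|ℓ²·[(A+2A²)Kδ_d + (4A∕3+6A²)K²m_d]`,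
  `ρ_x(f) = ℓ·min(d x,ℓ)·‖D*(c•Df)(x)‖ ≤ ρ₃(f)`, `K = δ + δ′`, `A = e^{R₀}e^{R₀+K}`, smallness `A·K ≤ ½`.
Every summand is (an X-row of `ψ` or `ψ′`) × (an X-row of `ψ − ψ′`), so this is the `P₂`-contribution to `q(Nψ − Nψ′) ≤ C_N(pψ + pψ′ + s)p(ψ − ψ′)` of ✓p667460's `hN`
(the `(p,q)` repackaging and the `P₁`, `P₃` pieces — F1 equivariant∕crude rules with F2's rows — remain; see the LOCATE §6).  HONEST SCOPE.  Assembly ([folklore]).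

References: T. Bałaban, CMP 99 (1985) 389–434 [Balaban1985BackgroundPropagators] ((3.8) p.392); CMP 98 (1985) 17–51 [Balaban1985Averaging] ((26), (32)–(34) p.22).
-/

set_option autoImplicit false

noncomputable section

open scoped BigOperators Matrix.Norms.L2Operator Matrix
open NormedSpace

namespace Summit.QuantumFields.YangMills.Theorems.Prop7GaugePieceDivLipschitz

open Literature.MathematicalPhysics.QuantumFieldTheory.Balaban1983to89
open Finset
open B9Eq39Adjoint (R R_def R_add R_sub covD covDstar divB)
open Literature.Analysis.Calculus.ExpDifferential (gSer ad)
open Literature.Analysis.Complex (logOnePlus)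
open Summit.QuantumFields.YangMills.Theorems.Prop7ResumPartPackaged (norm_divB_resumPart_le covD_sub)
open Summit.QuantumFields.YangMills.Theorems.Prop7NonlinPartPackaged (norm_divB_nonlinPart_le)
open Summit.QuantumFields.YangMills.Theorems.Prop7ResumTermDivLipschitz (divB_sub)
open Summit.QuantumFields.YangMills.Theorems.Prop7ResumCoeffRows (coeff_map_sub coeff_map_sum coeff_equivariant norm_coeff_le_two_mul
  norm_coeff_sub_coeff_le norm_coeff_secondDiff_apply_le)

variable {n : Type*} [Fintype n] [DecidableEq n] [Nonempty n]
variable {S : Type*} {ι : Type*} [Fintype ι] (T : ι → Equiv.Perm S) (U : ι → S → (Matrix n n ℂ)ˣ)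

omit [Nonempty n] in
/-- `D*` is additive in the bond datum: `D*(A + A′) = D*A + D*A′`. [folklore] -/
theorem divB_add' (A A' : ι → S → Matrix n n ℂ) (x : S) :
    divB T U (fun μ y => A μ y + A' μ y) x = divB T U A x + divB T U A' x := by
  simp only [divB, covDstar, R_add, ← Finset.sum_add_distrib]
  exact Finset.sum_congr rfl fun μ _ => by abel

/-- ★★★ **THE PURE-GAUGE PIECE UNDER `ℓ²D*`, DIVERGENCE-LIPSCHITZ ROW** (see the module docstring for the letters and the shape of the bound).
[cite: Balaban1985BackgroundPropagators, (3.8) p.392] [cite: Balaban1985Averaging, (32)-(34) p.22] -/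
theorem norm_divB_gaugePiece_sub_le
    (hR : ∀ μ x (M : Matrix n n ℂ), ‖R (U μ x) M‖ = ‖M‖) (hRn : ∀ μ x (M : Matrix n n ℂ), ‖R (U μ x)⁻¹ M‖ = ‖M‖)
    {c : ℂ} (hc : ‖c‖ ≤ 1) (ψ ψ' : S → Matrix n n ℂ) {R₀ m m' md δ δ' δd : ℝ}
    (hm : ∀ y, ‖ψ y‖ ≤ m) (hmR : m ≤ R₀) (hmhalf : m ≤ 1 / 2) (hm' : ∀ y, ‖ψ' y‖ ≤ m') (hm'R : m' ≤ R₀) (hmd : ∀ y, ‖ψ y - ψ' y‖ ≤ md)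
    (hδ0 : 0 ≤ δ) (hδ : ∀ μ y, ‖covD T U μ ψ y‖ ≤ δ) (hδ'0 : 0 ≤ δ') (hδ' : ∀ μ y, ‖covD T U μ ψ' y‖ ≤ δ')
    (hδd0 : 0 ≤ δd) (hδd : ∀ μ y, ‖covD T U μ (fun z => ψ z - ψ' z) y‖ ≤ δd)
    (C : Set S) (hC : ∀ y ∈ C, ψ y = 0) (hC' : ∀ y ∈ C, ψ' y = 0)
    (d : S → ℕ) (hd : ∀ y, y ∉ C → ∃ μ, d (T μ y) + 1 ≤ d y ∨ d ((T μ).symm y) + 1 ≤ d y)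
    (hs : Real.exp R₀ * Real.exp (R₀ + (δ + δ')) * (δ + δ') ≤ 1 / 2) (ℓ : ℕ) (x : S) :
    (ℓ : ℝ) ^ 2 * ‖divB T U (fun μ y =>
        (logOnePlus (exp (-(c • ψ y)) * (exp (c • ψ y + c • covD T U μ ψ y) - exp (c • ψ y))) - c • covD T U μ ψ y)
          - (logOnePlus (exp (-(c • ψ' y)) * (exp (c • ψ' y + c • covD T U μ ψ' y) - exp (c • ψ' y))) - c • covD T U μ ψ' y)) x‖
      ≤ 2 * max ((ℓ : ℝ) * δ) m * ((ℓ : ℝ) * min (d x : ℝ) ℓ * ‖divB T U (fun μ y => c • covD T U μ (fun z => ψ z - ψ' z) y) x‖)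
        + 2 * Real.exp (2 * R₀) * max ((ℓ : ℝ) * δd) md * ((ℓ : ℝ) * min (d x : ℝ) ℓ * ‖divB T U (fun μ y => c • covD T U μ ψ' y) x‖)
        + (Fintype.card ι : ℝ) * (ℓ : ℝ) ^ 2 * (2 * Real.exp (2 * R₀) * δ * δd + 2 * Real.exp (2 * R₀) * (δd + 4 * δ' * md) * δ')
        + 2 * (Fintype.card ι : ℝ) * (ℓ : ℝ) ^ 2 *
          ((((Real.exp R₀ * Real.exp (R₀ + (δ + δ'))) + 2 * (Real.exp R₀ * Real.exp (R₀ + (δ + δ'))) ^ 2) * (δ + δ') * δd)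
            + ((4 / 3 * (Real.exp R₀ * Real.exp (R₀ + (δ + δ'))) + 6 * (Real.exp R₀ * Real.exp (R₀ + (δ + δ'))) ^ 2) * (δ + δ') ^ 2 * md)) := by
  -- split `P₂ = ĉ(ψ y)(H) + 𝒩` bondwise and use additivity of `D*`
  have hsplit : (fun μ y =>
        (logOnePlus (exp (-(c • ψ y)) * (exp (c • ψ y + c • covD T U μ ψ y) - exp (c • ψ y))) - c • covD T U μ ψ y)
          - (logOnePlus (exp (-(c • ψ' y)) * (exp (c • ψ' y + c • covD T U μ ψ' y) - exp (c • ψ' y))) - c • covD T U μ ψ' y))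
      = fun μ y =>
        ((gSer ℂ (ad ℂ (c • ψ y)) (c • covD T U μ ψ y) - c • covD T U μ ψ y)
            - (gSer ℂ (ad ℂ (c • ψ' y)) (c • covD T U μ ψ' y) - c • covD T U μ ψ' y))
          + (((logOnePlus (exp (-(c • ψ y)) * (exp (c • ψ y + c • covD T U μ ψ y) - exp (c • ψ y))) - c • covD T U μ ψ y
                - (gSer ℂ (ad ℂ (c • ψ y)) (c • covD T U μ ψ y) - c • covD T U μ ψ y))
              - (logOnePlus (exp (-(c • ψ' y)) * (exp (c • ψ' y + c • covD T U μ ψ' y) - exp (c • ψ' y))) - c • covD T U μ ψ' y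
                - (gSer ℂ (ad ℂ (c • ψ' y)) (c • covD T U μ ψ' y) - c • covD T U μ ψ' y)))) := by
    funext μ y; abel
  rw [hsplit, divB_add']
  -- the resummed part, with F4b's coefficient rows
  have hA := norm_divB_resumPart_le T U hR hRn (fun lam Z => gSer ℂ (ad ℂ (c • lam)) Z - Z)
    (fun lam Z Z' => coeff_map_sub c lam Z Z')
    (fun lam f => coeff_map_sum Finset.univ c lam f)
    (fun μ y lam Z => by rw [R_def, R_def, R_def]; exact coeff_equivariant (U μ y)⁻¹ c lam Z)
    (fun lam Z hlam => norm_coeff_le_two_mul hc hlam Z)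
    (R₀ := R₀) (κ := 2 * Real.exp (2 * R₀)) (θ := 2 * Real.exp (2 * R₀)) (by positivity) (by positivity)
    (fun lam lam' Z hlam hlam' => norm_coeff_sub_coeff_le hc hlam hlam' Z)
    (fun a b a' b' Z ha hb ha' hb' => norm_coeff_secondDiff_apply_le hc ha hb ha' hb' Z)
    hc ψ ψ' hm hmR hmhalf hm' hm'R hmd hδ0 hδ hδ'0 hδ' hδd0 hδd C hC hC' d hd ℓ x
  -- the nonlinear part
  have hδd' : ∀ μ y, ‖covD T U μ ψ y - covD T U μ ψ' y‖ ≤ δd := fun μ y => by rw [← covD_sub]; exact hδd μ y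
  have hB := norm_divB_nonlinPart_le T U hRn hc ψ ψ' (fun y => (hm y).trans hmR) (fun y => (hm' y).trans hm'R) hmd hδ0 hδ hδ'0 hδ' hδd' hs ℓ x
  have hℓ2 : 0 ≤ (ℓ : ℝ) ^ 2 := sq_nonneg _
  beta_reduce at hA
  refine (mul_le_mul_of_nonneg_left (norm_add_le _ _) hℓ2).trans ?_
  linarith [hA, hB]

end Summit.QuantumFields.YangMills.Theorems.Prop7GaugePieceDivLipschitz

end
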